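import Summits.CriticalPhenomena.PercolationContinuityZ3.Theorems.PercNearOneGluingNoHeavyLowerTailSahiMixtureFourRefutation
import Summits.CriticalPhenomena.PercolationContinuityZ3.Theorems.SahiMasterFamilyTensorisation
import Literature.Combinatorics.Sahi2008.CumulationCone

/-!
# The AND-MIXTURE CONJECTURE IS A THEOREM — for every number of events, every sub-collection, every multiset

Support file of the one-cut programme (crux `NoHeavyLowerTail`, stmt-CriticalPhenomena-4575; cell `prim-masterthm`, seat P3, gen 6;
`run/shared/lean/prim/prim-masterthm/prim-masterthm-p3/HIERARCHY.md` §13).  Closes the conjecture `SahiMixture.AndMixtureBernsteinPositivity`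
typed in `…SahiMixtureFourRefutation` (gen 5; there a theorem for `n ≤ 3` only, and for `n = 4` known through ttrl cp-mix's nine exact
degree-5 certificates, MIXCOMB.md §7.3/§10.1 — which this file makes unnecessary).

THEOREM (`andMixture_bernsteinPos`, `andMixtureBernsteinPositivity_holds`).  Let `μ` be a weight on a finite type `α` and `A_0,…,A_{n−1}`
events that are Sahi-nonnegative at EVERY order (`AllOrders μ A`: `E_m(μ; 1_{A_{s 0}},…,1_{A_{s(m−1)}}) ≥ 0` for every slot map `s`).  AND an
independent coin `H` of bias `h` into the members `A_i`, `F i = true`.  Then for every multiset `s` the functional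
`h ↦ E_m(μ ⊗ coin(h); 1_{B_{s j}})`, `B_i = A_i ∩ ([F i] → H)`, is BERNSTEIN-POSITIVE of degree `m` on `[0,1]`; in particular
(`allOrders_andCoin`) the mixed family is again Sahi-nonnegative at every order for every `h ∈ [0,1]`.  No hypothesis on `n`, `F`, `s`.

PROOF (ten lines of mathematics).  `1_{A ∩ H}(a, ξ) = 1_A(a)·1_{ξ}` and `1_A(a, ξ) = 1_A(a)·1`: every slot is a PRODUCT of a function of
`a` and a function of the coin.  Seat P4's law of total cumulance in tensor form (`SahiTotalCumulance.sahiE_prod_tensor_eq`, any weights):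
  `E^{μ⊗ν}_m(φ⊗ψ) = Σ_{π ∈ Part([m])} [Π_{B∈π} E^μ_{|B|}(φ_B)] · E^ν_{|π|}(Π_{j∈B} ψ_j : B ∈ π)`.
Here each `E^μ_{|B|}(φ_B)` is a sub-multiset functional of `A` (`≥ 0` by hypothesis) and each block product `Π_{j∈B} ψ_j` is `1_{ξ}` or `1`,
so the coin factor is `E^{coin(h)}_{|π|}` of a family of copies of `H` and `Ω` — Bernstein-positive of degree `|π| ≤ m`
(`bernsteinPos_sahiE_coinLaw`: it is the AND-mixture functional of the all-`Ω` triple on the one-point space, an instance of the three-event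
theorem `andMixture_three`; explicitly `E_r(H^{×i}, Ω^{×(r−i)}) = c·h(1−h)(2−h)⋯(i−1−h)`, `c ≥ 0`).  ALL SIGNS PLUS.  ∎
Generating-function reading (HIERARCHY §13): with `G = Σ_τ E_τ t^τ` the square-free generating function of `A` and `G° = G|_{t_F = 0}`,
`1 − G_h = (1 − G°)^{1−h}(1 − G)^h`, and Sahi's one-variable elimination expansion [Sahi2008, p. 218] `G_h = G° + Σ_{k≥1} (−1)^{k−1}C(h,k)·
(G − G°)^k (1 − G°)^{1−k}` is termwise nonnegative because `G − G° ≥ 0` coefficientwise — the AND half of the mixture conjecture is "formal",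
the OR half is not (`G_{OR} − G` has the negative coefficients `−Cov(A_i,A_j)`, and indeed OR fails at `(n,|F|) = (4,2)`, `…SahiMixtureFourRefutation`).
HONEST FRAMING: a theorem about the AND half only; the OR half is false in general and its surviving cells (`|F| ≥ n − 1`) stay open beyond
`n = 4`; nothing is claimed about Sahi's conjecture `C_k`. [this work]
-/

noncomputable section

open scoped Classical

namespace Summit.CriticalPhenomena.PercolationContinuityZ3.Theorems

open Finset Function
open Literature.Combinatorics.Sahi2008
open Literature.Combinatorics.Sahi2008.PartitionForm
open Literature.Probability.Percolation.DecisionTree (ind ind_of_mem ind_of_not_mem ind_nonneg)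
open SahiTotalCumulance

namespace SahiMixture

/-! ### The coin factor of an AND-mixed slot -/

/-! Notation used in the docstrings: `coin(h)` is the weight `ξ ↦ (h if ξ else 1 − h)` on `Bool`; the COIN FACTOR of a slot with
mixing flag `b` is `andFactor b := ξ ↦ (1_{ξ} if b else 1)` — written out as a lambda below (no auxiliary definitions). -/

section Tensor

variable {α : Type*} [Fintype α]

omit [Fintype α] in
/-- **An AND-mixed slot is a tensor product**: `1_{A ∩ ([b] → H)}(a, ξ) = 1_A(a) · andFactor b ξ`. [this work] -/
theorem ind_andCoin_eq_tensor (A : Set α) (b : Bool) :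
    ind (andCoin A b) = fun p : α × Bool => ind A p.1 * (fun ξ : Bool => bif b then (bif ξ then (1 : ℝ) else 0) else 1) p.2 := by
  funext p
  obtain ⟨a, ξ⟩ := p
  cases ξ <;> cases b <;> simp

end Tensor

/-- A product of coin factors is a coin factor (`1_{true}` if some factor is, else `1`). [this work] -/
theorem prod_andFactor {k : ℕ} (b : Fin k → Bool) :
    ∃ t : Bool, (fun ξ : Bool => ∏ j, (fun ξ : Bool => bif b j then (bif ξ then (1 : ℝ) else 0) else 1) ξ) = (fun ξ : Bool => bif t then (bif ξ then (1 : ℝ) else 0) else 1) := by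
  by_cases hb : ∃ j, b j = true
  · obtain ⟨j, hj⟩ := hb
    refine ⟨true, ?_⟩
    funext ξ
    cases ξ
    · have h0 : (fun ξ : Bool => bif b j then (bif ξ then (1 : ℝ) else 0) else 1) false = 0 := by rw [hj]; rfl
      rw [Finset.prod_eq_zero (Finset.mem_univ j) h0]; rfl
    · have h1 : ∀ i, (fun ξ : Bool => bif b i then (bif ξ then (1 : ℝ) else 0) else 1) true = 1 := fun i => by cases b i <;> rfl
      simp only [h1, Finset.prod_const_one]; rfl
  · refine ⟨false, ?_⟩
    funext ξ
    have hb' : ∀ i, b i = false := fun i => by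
      cases hi : b i
      · rfl
      · exact absurd ⟨i, hi⟩ hb
    have h1 : ∀ i, (fun ξ : Bool => bif b i then (bif ξ then (1 : ℝ) else 0) else 1) ξ = 1 := fun i => by rw [hb']; rfl
    simp only [h1, Finset.prod_const_one]; rfl

/-- The all-`Ω` triple on the one-point space is Sahi-nonnegative at every order (`E_m(1,…,1) ∈ {0, 1}`). [folklore] -/
theorem allOrders_univ_unit : AllOrders (fun _ : Unit => (1 : ℝ)) (fun _ : Fin 3 => (Set.univ : Set Unit)) := by
  intro m s
  have hfam : (fun j => ind ((fun _ : Fin 3 => (Set.univ : Set Unit)) (s j))) = fun _ => (1 : Unit → ℝ) := by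
    funext j u; exact ind_of_mem (Set.mem_univ u)
  have h1 : ∑ u : Unit, (fun _ : Unit => (1 : ℝ)) u = 1 := by simp
  rw [hfam]
  rcases m with _ | _ | m
  · rw [sahiE_zero]
  · rw [sahiE_one_apply]
    have : ex (fun _ : Unit => (1 : ℝ)) ((fun _ : Fin 1 => (1 : Unit → ℝ)) 0) = 1 := ex_one h1
    rw [this]; exact zero_le_one
  · rw [sahiE_const_one h1 m]

/-- **Coin families are Bernstein-positive**: for the coin of bias `h` and any family each of whose slots is `1_{H}` or `1`,
`h ↦ E_r(coin(h); …)` is Bernstein-positive of degree `r` (explicitly `E_r(H^{×i}, Ω^{×(r−i)}) = c_{r,i}·h(1−h)(2−h)⋯(i−1−h)`, `c ≥ 0`).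
Obtained from the three-event AND-mixture theorem on the one-point space. [this work] -/
theorem bernsteinPos_sahiE_coinLaw {r : ℕ} (t : Fin r → Bool) :
    BernsteinPos r (fun h => sahiE (fun ξ : Bool => bif ξ then h else 1 - h) r (fun m => (fun ξ : Bool => bif t m then (bif ξ then (1 : ℝ) else 0) else 1))) := by
  have h1 : ∑ u : Unit, (fun _ : Unit => (1 : ℝ)) u = 1 := by simp
  have h3 := andMixture_three Unit (fun _ => (1 : ℝ)) (fun _ => zero_le_one) h1 (fun _ => Set.univ) ![true, false, false]
    allOrders_univ_unit r (fun m => bif t m then 0 else 1)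
  refine h3.congr fun h _ _ => ?_
  -- read the coin family on `Unit × Bool` along `Bool ≃ Unit × Bool`
  let eqv : Bool ≃ Unit × Bool := ⟨fun ξ => ((), ξ), fun p => p.2, fun _ => rfl, fun _ => rfl⟩
  have e := sahiE_comp_equiv eqv (coinWeight (fun _ : Unit => (1 : ℝ)) h) r
    (fun j => ind (andCoin ((fun _ : Fin 3 => (Set.univ : Set Unit)) ((fun m => bif t m then (0 : Fin 3) else 1) j))
      ((![true, false, false] : Fin 3 → Bool) ((fun m => bif t m then (0 : Fin 3) else 1) j))))
  rw [← e]
  congr 1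
  · funext ξ
    cases ξ <;> simp [coinWeight, eqv]
  · funext j ξ
    cases ht : t j <;> cases ξ <;> simp [ht, eqv, ind_of_mem]

/-! ### The theorem -/

section Main

variable {α : Type*} [Fintype α] {μ : α → ℝ} {n : ℕ} (A : Fin n → Set α) (F : Fin n → Bool)

/-- **THE AND-MIXTURE THEOREM (every `n`, `F`, multiset).**  If `A_0,…,A_{n−1}` are Sahi-nonnegative at every order under the weight `μ`, then
for every `F` and every slot map `s`, `h ↦ E_m(μ ⊗ coin(h); 1_{A_{s j} ∩ ([F (s j)] → H)})` is Bernstein-positive of degree `m`.  Proof: the slots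
are tensor products; the law of total cumulance in tensor form (`sahiE_prod_tensor_eq`) writes the functional as a sum over set partitions of
(product of sub-multiset functionals of `A`, all `≥ 0`) × (a coin-family functional, Bernstein-positive); all signs plus. [this work] -/
theorem andMixture_bernsteinPos (hA : AllOrders μ A) (m : ℕ) (s : Fin m → Fin n) :
    BernsteinPos m (fun h => sahiE (coinWeight μ h) m (fun j => ind (andCoin (A (s j)) (F (s j))))) := by
  rcases m with _ | k
  · exact (bernsteinPos_const 0 le_rfl).congr fun h _ _ => by rw [sahiE_zero]
  · have hfam : (fun j => ind (andCoin (A (s j)) (F (s j)))) =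
        fun j (p : α × Bool) => ind (A (s j)) p.1 * (fun ξ : Bool => bif F (s j) then (bif ξ then (1 : ℝ) else 0) else 1) p.2 := by
      funext j; rw [ind_andCoin_eq_tensor]
    have key : ∀ h : ℝ, sahiE (coinWeight μ h) (k + 1) (fun j => ind (andCoin (A (s j)) (F (s j)))) =
        ∑ c : OrderedFinpartition (k + 1),
          (∏ m : Fin c.length, sahiE μ (block c m).card (fun j => ind (A (s ((block c m).orderEmbOfFin rfl j))))) *
            sahiE (fun ξ : Bool => bif ξ then h else 1 - h) c.length
              (fun m ξ => ∏ j : Fin (block c m).card, (fun ξ : Bool => bif F (s ((block c m).orderEmbOfFin rfl j)) then (bif ξ then (1 : ℝ) else 0) else 1) ξ) := fun h => by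
      have e := sahiE_prod_tensor_eq μ (fun ξ : Bool => bif ξ then h else 1 - h) k (fun j a => ind (A (s j)) a) (fun j => (fun ξ : Bool => bif F (s j) then (bif ξ then (1 : ℝ) else 0) else 1))
      rw [hfam]
      exact e
    refine (BernsteinPos.sum (m := k + 1) univ
      (Φ := fun (c : OrderedFinpartition (k + 1)) (h : ℝ) =>
        (∏ m : Fin c.length, sahiE μ (block c m).card (fun j => ind (A (s ((block c m).orderEmbOfFin rfl j))))) *
          sahiE (fun ξ : Bool => bif ξ then h else 1 - h) c.length
            (fun m ξ => ∏ j : Fin (block c m).card, (fun ξ : Bool => bif F (s ((block c m).orderEmbOfFin rfl j)) then (bif ξ then (1 : ℝ) else 0) else 1) ξ))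
      fun c _ => ?_).congr fun h _ _ => key h
    -- one set partition: a nonnegative constant times a coin-family functional
    have hC : 0 ≤ ∏ m : Fin c.length, sahiE μ (block c m).card (fun j => ind (A (s ((block c m).orderEmbOfFin rfl j)))) :=
      prod_nonneg fun m _ => hA _ _
    choose t ht using fun m : Fin c.length =>
      prod_andFactor (fun j : Fin (block c m).card => F (s ((block c m).orderEmbOfFin rfl j)))
    have hcoin : (fun m ξ => ∏ j : Fin (block c m).card, (fun ξ : Bool => bif F (s ((block c m).orderEmbOfFin rfl j)) then (bif ξ then (1 : ℝ) else 0) else 1) ξ) =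
        fun m => (fun ξ : Bool => bif t m then (bif ξ then (1 : ℝ) else 0) else 1) := by
      funext m; exact ht m
    rw [hcoin]
    exact ((bernsteinPos_sahiE_coinLaw t).mono c.length_le).smul hC

/-- Hence **the AND-mixed family is Sahi-nonnegative at every order** for every bias `h ∈ [0,1]`. [this work] -/
theorem allOrders_andCoin (hA : AllOrders μ A) {h : ℝ} (h0 : 0 ≤ h) (h1 : h ≤ 1) :
    AllOrders (coinWeight μ h) (fun i => andCoin (A i) (F i)) :=
  fun m s => (andMixture_bernsteinPos A F hA m s).nonneg h0 h1

end Main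

/-- **`AndMixtureBernsteinPositivity` HOLDS** (the conjecture typed in `…SahiMixtureFourRefutation`, gen 5, is a theorem). [this work] -/
theorem andMixtureBernsteinPositivity_holds : AndMixtureBernsteinPositivity :=
  fun _ _ _ _ _ _ A F hA m s => andMixture_bernsteinPos A F hA m s

end SahiMixture

end Summit.CriticalPhenomena.PercolationContinuityZ3.Theorems

end
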